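import Summits.Langlands.Langlands.Theses.DyadicOddResidue
import Summits.Langlands.Langlands.Theorems.DyadicOddResidueDyadicDihedralFMDictionary
import HarnessLib

/-!
# Route `DyadicOddResidue`, item stmt-Langlands-18169: the glue `DyadicDihedralFMGlue`

The support item `DyadicDihedralFMGlue` of the route `DyadicOddResidue` is the cell split of the
dihedral crux `DyadicDihedralFM` (K2, Fontaine–Mazur for `GL₂/ℚ` at `ℓ = 2` in the residually
dihedral case):

  `DihedralProModularityCore → ProModularClassicality → DyadicDihedralPrintedCellsFM → DyadicDihedralFM`.

It is pure logic over the landed dictionary theorem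
`Summit.Langlands.Langlands.Theorems.DyadicDihedralFM.stub_dictionary`
(file `DyadicOddResidueDyadicDihedralFMDictionary.lean`): at `ℓ = 2`, for `ρ` as in the crux,
case on the two printed dihedral cells (Thorne's potentially crystalline weight-`2` ordinary cell /
Allen's nearly ordinary cell with condition (5)).  ON a cell, `DyadicDihedralPrintedCellsFM` gives a
Tate twist `ρ ⊗ ε₂^m` attached to a newform away from `2N`; OFF both cells, the open core
`DihedralProModularityCore` gives `2`-adic automorphy of some tame level and
`ProModularClassicality` (Pan II classicality, every prime, used at `p = 2`) gives the Tate-twist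
newform.  In both cases the dictionary turns the newform into the `L`-algebraic cuspidal `π` of
`GL₂(𝔸_ℚ)` which is Satake–Frobenius compatible with `ρ` at almost every place.

No statement of the route file is altered.  Sorry-free; axioms `propext`, `Classical.choice`,
`Quot.sound`.
-/

namespace Summit.Langlands.Langlands.Theorems

set_option linter.dupNamespace false -- project-wide option; `Summit.Langlands.Langlands` is the mandated namespace

open Summit.Langlands.Langlands.Theses.DyadicOddResidue

/-- **The glue of the dihedral cell split (item stmt-Langlands-18169).**
`DihedralProModularityCore → ProModularClassicality → DyadicDihedralPrintedCellsFM → DyadicDihedralFM`: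
at `ℓ = 2`, for a residually dihedral, irreducible, odd, a.e. unramified `ρ : Γ_ℚ → GL₂(ℚ̄₂)` de Rham
at `2` with distinct labelled Hodge–Tate weights, a Tate twist of `ρ` is attached to a newform —
by the printed cells when `ρ` lies on one of them, and by the core (pro-modularity) followed by
Pan II classicality at `p = 2` otherwise — and the dictionary
`DyadicDihedralFM.stub_dictionary` converts the newform into an `L`-algebraic cuspidal `π` with
almost-everywhere Satake–Frobenius compatibility. -/
theorem DyadicDihedralFMGlue_proof :
    Summit.Langlands.Langlands.Theses.DyadicOddResidue.DyadicDihedralFMGlue := by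
  unfold Summit.Langlands.Langlands.Theses.DyadicOddResidue.DyadicDihedralFMGlue
  intro hcore hclass hcells ℓ _ hℓ
  subst hℓ
  intro ρ hres hsol hirr hodd hunr hdR hcpt ι
  -- the dictionary: a Tate-twist newform for `ρ` suffices
  refine DyadicDihedralFM.stub_dictionary 2 ρ ?_ hcpt ι
  -- case on the two printed cells: ON a cell the cells hypothesis gives the newform …
  refine (Classical.em _).elim (hcells ρ hres hsol hirr hodd hunr hdR) fun hcell => ?_
  -- … OFF both cells: the core gives `2`-adic automorphy, Pan II classicality the newform
  rw [not_or] at hcell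
  exact hclass 2 ρ hres hirr hunr hdR (hcore ρ hres hsol hirr hodd hunr hdR hcell.1 hcell.2)

end Summit.Langlands.Langlands.Theorems
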